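import Summits.ResolutionOfSingularities.ResolutionOfSingularities.Theorems.PAlterationPalterationThesisR1DStep
import Summits.ResolutionOfSingularities.ResolutionOfSingularities.Theorems.PAlterationPalterationThesisPerfectQuotient
import HarnessLib

/-!
# Crux `PalterationThesis` (stmt-ResolutionOfSingularities-0552), line `Sketch` rev. c2:
# PICover over a perfect field ⟺ `R1D` (card 2's `R1Perfect`: `W^L` for a coatom `L` of `K(W)^{1/p}`)

Route `ResolutionOfSingularities/pAlteration`; assembly file of cycle 2 of the rev. c2 reshape
(`--supports stmt-0552`). `R1D_K` (card `Ideas/multiplicative-residue-tame-destack.md`, residue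
`R1Perfect`, in Frobenius-twisted coordinates — see `PAlterationPalterationThesisR1DStep.lean`):
for `B` regular integral separated of finite type over the perfect field `K`, a finite
extension `E/K(B)` and `β : E → K(B)` with `β ∘ (K(B) → E) = Frobenius` and `[K(B) : β(E)] = p`,
the normalisation `B^E` (= the quotient of `B^{1/p} ≅ B` by ONE `p`-closed vector field) has a
resolution. Proved here, for `K` perfect of characteristic `p`:

* `finiteDimensional_subfield_of_pow_mem` — F-finiteness: `K(B)` is finite over every subfield
  containing the `p`-th powers (the Frobenius power endomorphism of `B` is finite);
* `claimD_of_r1D` — `R1D_K ⟹` the same at every index `p^M` (induction: index `1` by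
  `stub_core` at `M = 0` and the degree-one base case, step `claimD_succ`);
  `core_of_r1D` — hence the hypothesis `hCore` of `stub_degP_of_core`;
* `picoverOver_of_r1D`, `r1D_of_picoverOver`, `picoverOver_iff_r1D` — **PICover over `K` ⟺
  `R1D_K`**; `r1_iff_r1D` — the two residues `R1_K` (degree-`p` radicial QUOTIENTS of regular
  varieties) and `R1D_K` (index-`p` twisted NORMALISATIONS of regular varieties) are equivalent;
* `palterationThesis_iff_pialtPerfect_r1DPerfect_descent` — the crux ⟺ (Abramovich–Oort over
  perfect fields ∧ `R1D` over perfect fields, every prime) ∧ `DescentPerfectToAll`.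
-/

set_option linter.dupNamespace false

noncomputable section

open CategoryTheory AlgebraicGeometry TopologicalSpace
open Literature.AlgebraicGeometry.Resolution Literature.AlgebraicGeometry.Motives
open Summit.ResolutionOfSingularities.ResolutionOfSingularities.Theses.PAlteration
open Summit.ResolutionOfSingularities.ResolutionOfSingularities.Theses.Descent (DescentPerfectToAll)

namespace Summit.ResolutionOfSingularities.ResolutionOfSingularities.Theorems.PalterationThesis.PerfectQuotient

/-! ## F-finiteness -/

/-- **F-finiteness of function fields over a perfect field**: for `B` integral, locally of finite
type over a perfect field `K` of characteristic `p`, `K(B)` is finite over every subfield `S`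
containing all `p`-th powers (the Frobenius power endomorphism of `B` is finite, so `K(B)` is
finite over `K(B)^p ⊆ S`). [folklore] -/
theorem finiteDimensional_subfield_of_pow_mem (p : ℕ) (hp : p.Prime) (K : Type) [Field K]
    [CharP K p] [PerfectField K] (B : Scheme.{0}) [IsIntegral B] (f : B ⟶ Spec (.of K))
    [LocallyOfFiniteType f] (S : Subfield B.functionField)
    (hS : ∀ b : B.functionField, b ^ p ∈ S) : FiniteDimensional S B.functionField := by
  classical
  haveI : Fact p.Prime := ⟨hp⟩
  have hpB : (p : Γ(B, ⊤)) = 0 := natCast_appTop_eq_zero p f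
  have hadd := add_pow_sections p hpB 1
  set F := powEndo B (p ^ 1) (pow_ne_zero 1 hp.ne_zero) hadd with hFdef
  haveI : IsFinite F := isFinite_powEndo p f 1 hadd
  haveI : Surjective F := ⟨fun x => ⟨x, rfl⟩⟩
  have hF : ∀ y : B.functionField, RatFn.functionFieldMap F y = y ^ p ^ 1 :=
    functionFieldMap_powEndo B (p ^ 1) _ hadd
  -- a finite spanning set of the finite `K(B)`-module `(K(B), F^♯)`
  obtain ⟨T, hT⟩ := Module.Finite.fg_top (R := B.functionField) (M := FunctionFieldOver F)
  refine ⟨⟨T.image (FunctionFieldOver.of F).symm, ?_⟩⟩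
  rw [eq_top_iff]
  rintro x -
  have hx : FunctionFieldOver.of F x ∈ Submodule.span B.functionField (T : Set (FunctionFieldOver F)) := by
    rw [hT]; exact Submodule.mem_top
  obtain ⟨c, -, hc⟩ := Submodule.mem_span_finset.mp hx
  have hx' : x = ∑ i ∈ T, (c i) ^ p * (FunctionFieldOver.of F).symm i := by
    apply (FunctionFieldOver.of F).injective
    rw [← hc, map_sum]
    refine Finset.sum_congr rfl fun i _ => ?_
    rw [map_mul, RingEquiv.apply_symm_apply, Algebra.smul_def, FunctionFieldOver.algebraMap_apply, hF,
      pow_one, map_pow]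
  rw [hx']
  refine Submodule.sum_mem _ fun i hi => ?_
  have h1 : (c i) ^ p * (FunctionFieldOver.of F).symm i =
      (⟨(c i) ^ p, hS _⟩ : S) • (FunctionFieldOver.of F).symm i := rfl
  rw [h1]
  refine Submodule.smul_mem _ _ (Submodule.subset_span ?_)
  simp only [Finset.coe_image, Set.mem_image, Finset.mem_coe]
  exact ⟨i, hi, rfl⟩

/-! ## `R1D` at every index -/

/-- **Index one** (the case `M = 0` of `ClaimD`): if `[K(B) : β(E)] = 1` then `B^E` has a
resolution — `stub_core` at `M = 0`, whose only input is the degree-one base case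
`hasResolution_of_finrank_eq_one`. [folklore] -/
theorem claimD_zero (p : ℕ) (hp : p.Prime) (K : Type) [Field K] [CharP K p] [PerfectField K]
    (B : Scheme.{0}) [IsIntegral B] (f : B ⟶ Spec (.of K)) [IsSeparated f]
    [LocallyOfFiniteType f] [QuasiCompact f] (hBreg : Scheme.IsRegular B)
    (E : Type) [Field E] [Algebra B.functionField E] [FiniteDimensional B.functionField E]
    (β : E →+* B.functionField) (hβ : ∀ b : B.functionField, β (algebraMap B.functionField E b) = b ^ p)
    (hdeg : Module.finrank β.fieldRange B.functionField = 1) :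
    Scheme.HasResolution (normalizationIn B E) := by
  refine stub_core p hp K 0 (fun m hm X W _ _ _ h _ _ _ _ hXn hW hfin _ _ hdeg' => ?_) B f
    inferInstance inferInstance inferInstance hBreg E β hβ (by rw [hdeg, pow_zero])
  obtain rfl : m = 0 := Nat.le_zero.mp hm
  haveI := hfin
  rw [pow_zero] at hdeg'
  exact hasResolution_of_finrank_eq_one h hXn hW hdeg'

/-- **`R1D_K` implies `ClaimD_K M` for every `M`**: normalisations `B^E` of regular `B` inside
`K(B)^{1/p}` of every `β`-index `p^M` are resolvable, by induction on `M` (`claimD_zero`,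
`claimD_succ`). [folklore] -/
theorem claimD_of_r1D (p : ℕ) (hp : p.Prime) (K : Type) [Field K] [CharP K p] [PerfectField K]
    (hR1D : ∀ (B : Scheme.{0}) [IsIntegral B] (f : B ⟶ Spec (.of K)),
        IsSeparated f → LocallyOfFiniteType f → QuasiCompact f → Scheme.IsRegular B →
        ∀ (E : Type) [Field E] [Algebra B.functionField E] [FiniteDimensional B.functionField E]
          (β : E →+* B.functionField),
          (∀ b : B.functionField, β (algebraMap B.functionField E b) = b ^ p) →
          Module.finrank β.fieldRange B.functionField = p →
          Scheme.HasResolution (normalizationIn B E)) :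
    ∀ (M : ℕ) (B : Scheme.{0}) [IsIntegral B] (f : B ⟶ Spec (.of K)),
        IsSeparated f → LocallyOfFiniteType f → QuasiCompact f → Scheme.IsRegular B →
        ∀ (E : Type) [Field E] [Algebra B.functionField E] [FiniteDimensional B.functionField E]
          (β : E →+* B.functionField),
          (∀ b : B.functionField, β (algebraMap B.functionField E b) = b ^ p) →
          Module.finrank β.fieldRange B.functionField = p ^ M →
          Scheme.HasResolution (normalizationIn B E) := by
  intro M
  induction M with
  | zero =>
    intro B _ f hs hl hq hBreg E _ _ _ β hβ hdeg
    haveI := hs; haveI := hl; haveI := hq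
    rw [pow_zero] at hdeg
    exact claimD_zero p hp K B f hBreg E β hβ hdeg
  | succ M IH =>
    intro B _ f hs hl hq hBreg E _ _ _ β hβ hdeg
    haveI := hs; haveI := hl; haveI := hq
    exact claimD_succ p hp K M hR1D IH B f hBreg E β hβ hdeg

/-- **`R1D_K` implies `Core_K` for every `M`** (the hypothesis shape of `stub_degP_of_core`): an
index `[K(B) : β(E)] ≤ p^M` is a power of `p` (F-finiteness + pure inseparability), so
`claimD_of_r1D` applies. [folklore] -/
theorem core_of_r1D (p : ℕ) (hp : p.Prime) (K : Type) [Field K] [CharP K p] [PerfectField K]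
    (hR1D : ∀ (B : Scheme.{0}) [IsIntegral B] (f : B ⟶ Spec (.of K)),
        IsSeparated f → LocallyOfFiniteType f → QuasiCompact f → Scheme.IsRegular B →
        ∀ (E : Type) [Field E] [Algebra B.functionField E] [FiniteDimensional B.functionField E]
          (β : E →+* B.functionField),
          (∀ b : B.functionField, β (algebraMap B.functionField E b) = b ^ p) →
          Module.finrank β.fieldRange B.functionField = p →
          Scheme.HasResolution (normalizationIn B E)) :
    ∀ (M : ℕ) (B : Scheme.{0}) [IsIntegral B] (f : B ⟶ Spec (.of K)),
        IsSeparated f → LocallyOfFiniteType f → QuasiCompact f → Scheme.IsRegular B →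
        ∀ (E : Type) [Field E] [Algebra B.functionField E] [FiniteDimensional B.functionField E]
          (β : E →+* B.functionField),
          (∀ b : B.functionField, β (algebraMap B.functionField E b) = b ^ p) →
          Module.finrank β.fieldRange B.functionField ≤ p ^ M →
          Scheme.HasResolution (normalizationIn B E) := by
  intro M B _ f hs hl hq hBreg E _ _ _ β hβ _
  haveI : Fact p.Prime := ⟨hp⟩
  haveI := hl
  haveI : CharP B.functionField p := Picover.TowerTransport.charP_functionField B f
  have hSp : ∀ b : B.functionField, b ^ p ∈ β.fieldRange :=
    fun b => ⟨algebraMap B.functionField E b, hβ b⟩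
  haveI : CharP β.fieldRange p :=
    ((algebraMap β.fieldRange B.functionField).charP_iff_charP p).mpr inferInstance
  haveI : ExpChar β.fieldRange p := ExpChar.prime hp
  haveI : FiniteDimensional β.fieldRange B.functionField :=
    finiteDimensional_subfield_of_pow_mem p hp K B f β.fieldRange hSp
  haveI : IsPurelyInseparable β.fieldRange B.functionField := by
    rw [isPurelyInseparable_iff_pow_mem β.fieldRange p]
    exact fun x => ⟨1, ⟨x ^ p, hSp x⟩, by rw [pow_one]; rfl⟩
  obtain ⟨j, hj⟩ := IsPurelyInseparable.finrank_eq_pow β.fieldRange B.functionField p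
  exact claimD_of_r1D p hp K hR1D j B f hs hl hq hBreg E β hβ hj

/-! ## PICover over a perfect field ⟺ `R1D` -/

/-- **`R1D_K ⟹ PICover over K`**, `K` perfect: through `core_of_r1D`, `stub_degP_of_core` and
`stub_picoverOver_of_degP`. [folklore] -/
theorem picoverOver_of_r1D (p : ℕ) (hp : p.Prime) (K : Type) [Field K] [CharP K p]
    [PerfectField K]
    (hR1D : ∀ (B : Scheme.{0}) [IsIntegral B] (f : B ⟶ Spec (.of K)),
        IsSeparated f → LocallyOfFiniteType f → QuasiCompact f → Scheme.IsRegular B →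
        ∀ (E : Type) [Field E] [Algebra B.functionField E] [FiniteDimensional B.functionField E]
          (β : E →+* B.functionField),
          (∀ b : B.functionField, β (algebraMap B.functionField E b) = b ^ p) →
          Module.finrank β.fieldRange B.functionField = p →
          Scheme.HasResolution (normalizationIn B E)) :
    ∀ (Y X : Scheme.{0}) (f : Y ⟶ Spec (.of K)) (g : X ⟶ Y),
      IsSeparated f → LocallyOfFiniteType f → QuasiCompact f → IsIntegral Y →
      Scheme.IsRegular Y → IsIntegral X → IsFinite g → UniversallyInjective g →
      Function.Surjective g.base → Scheme.HasResolution X :=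
  stub_picoverOver_of_degP p hp K (stub_degP_of_core p hp K (core_of_r1D p hp K hR1D))

/-- **PICover over `K` ⟹ `R1D_K`**, `K` perfect: `stub_core` at `M = 1`, fed with the
exponent-one quotients of degree `≤ p` that PICover resolves (`expOneQuot_of_picoverOver`).
[folklore] -/
theorem r1D_of_picoverOver (p : ℕ) (hp : p.Prime) (K : Type) [Field K] [CharP K p]
    [PerfectField K]
    (hPC : ∀ (Y X : Scheme.{0}) (f : Y ⟶ Spec (.of K)) (g : X ⟶ Y),
      IsSeparated f → LocallyOfFiniteType f → QuasiCompact f → IsIntegral Y →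
      Scheme.IsRegular Y → IsIntegral X → IsFinite g → UniversallyInjective g →
      Function.Surjective g.base → Scheme.HasResolution X) :
    ∀ (B : Scheme.{0}) [IsIntegral B] (f : B ⟶ Spec (.of K)),
        IsSeparated f → LocallyOfFiniteType f → QuasiCompact f → Scheme.IsRegular B →
        ∀ (E : Type) [Field E] [Algebra B.functionField E] [FiniteDimensional B.functionField E]
          (β : E →+* B.functionField),
          (∀ b : B.functionField, β (algebraMap B.functionField E b) = b ^ p) →
          Module.finrank β.fieldRange B.functionField = p →
          Scheme.HasResolution (normalizationIn B E) := by
  intro B _ f hs hl hq hBreg E _ _ _ β hβ hdeg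
  exact stub_core p hp K 1 (fun m _ => expOneQuot_of_picoverOver p hp K hPC m) B f hs hl hq
    hBreg E β hβ (by rw [hdeg, pow_one])

/-- **PICover over a perfect field `K` ⟺ `R1D_K`**: resolution of finite radicial covers of
regular varieties over `K` is equivalent to the resolution of the normalisations `B^E` of regular
varieties `B` in the index-`p` subextensions `E` of `K(B)^{1/p}` — quotients of `B^{1/p} ≅ B` by
one `p`-closed vector field (card `multiplicative-residue-tame-destack`, `R1Perfect`). [folklore] -/
theorem picoverOver_iff_r1D (p : ℕ) (hp : p.Prime) (K : Type) [Field K] [CharP K p]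
    [PerfectField K] :
    (∀ (Y X : Scheme.{0}) (f : Y ⟶ Spec (.of K)) (g : X ⟶ Y),
      IsSeparated f → LocallyOfFiniteType f → QuasiCompact f → IsIntegral Y →
      Scheme.IsRegular Y → IsIntegral X → IsFinite g → UniversallyInjective g →
      Function.Surjective g.base → Scheme.HasResolution X) ↔
    ∀ (B : Scheme.{0}) [IsIntegral B] (f : B ⟶ Spec (.of K)),
        IsSeparated f → LocallyOfFiniteType f → QuasiCompact f → Scheme.IsRegular B →
        ∀ (E : Type) [Field E] [Algebra B.functionField E] [FiniteDimensional B.functionField E]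
          (β : E →+* B.functionField),
          (∀ b : B.functionField, β (algebraMap B.functionField E b) = b ^ p) →
          Module.finrank β.fieldRange B.functionField = p →
          Scheme.HasResolution (normalizationIn B E) :=
  ⟨r1D_of_picoverOver p hp K, picoverOver_of_r1D p hp K⟩

/-- **`R1_K ⟺ R1D_K`** over a perfect field `K`: resolving normal degree-`p` radicial
QUOTIENTS of regular varieties is equivalent to resolving index-`p` twisted NORMALISATIONS of
regular varieties (both are equivalent to PICover over `K`). [folklore] -/
theorem r1_iff_r1D (p : ℕ) (hp : p.Prime) (K : Type) [Field K] [CharP K p] [PerfectField K] :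
    (∀ (X W : Scheme.{0}) [IsIntegral X] [IsIntegral W] (f : X ⟶ Spec (.of K)) (h : W ⟶ X)
      [IsDominant h], IsSeparated f → LocallyOfFiniteType f → QuasiCompact f →
      (∀ x : X, IsIntegrallyClosed (X.presheaf.stalk x)) → Scheme.IsRegular W →
      IsFinite h → UniversallyInjective h →
      Module.finrank X.functionField (FunctionFieldOver h) = p →
      Scheme.HasResolution X) ↔
    ∀ (B : Scheme.{0}) [IsIntegral B] (f : B ⟶ Spec (.of K)),
        IsSeparated f → LocallyOfFiniteType f → QuasiCompact f → Scheme.IsRegular B →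
        ∀ (E : Type) [Field E] [Algebra B.functionField E] [FiniteDimensional B.functionField E]
          (β : E →+* B.functionField),
          (∀ b : B.functionField, β (algebraMap B.functionField E b) = b ^ p) →
          Module.finrank β.fieldRange B.functionField = p →
          Scheme.HasResolution (normalizationIn B E) :=
  (picoverOver_iff_r1 p hp K).symm.trans (picoverOver_iff_r1D p hp K)

/-! ## The crux with the Picover half as `R1D` -/

/-- **The crux `PalterationThesis` is equivalent to: the Abramovich–Oort conjecture over perfect
fields, `R1D` over perfect fields (for every prime `p`), and `DescentPerfectToAll`.** [folklore] -/
theorem palterationThesis_iff_pialtPerfect_r1DPerfect_descent :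
    PalterationThesis ↔
      (∀ p : ℕ, p.Prime → ∀ (K : Type) [Field K] [CharP K p] [PerfectField K],
        (∀ (X : Scheme.{0}) (f : X ⟶ Spec (.of K)),
          IsSeparated f → LocallyOfFiniteType f → QuasiCompact f → IsIntegral X →
          ∃ (X' : Scheme.{0}) (g : X' ⟶ X), IsProper g ∧ IsIntegral X' ∧ Scheme.IsRegular X' ∧
            Function.Surjective g.base ∧ ∃ U : X.Opens, Dense (U : Set X) ∧ IsFinite (g ∣_ U) ∧
            UniversallyInjective (g ∣_ U)) ∧
        (∀ (B : Scheme.{0}) [IsIntegral B] (f : B ⟶ Spec (.of K)),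
          IsSeparated f → LocallyOfFiniteType f → QuasiCompact f → Scheme.IsRegular B →
          ∀ (E : Type) [Field E] [Algebra B.functionField E] [FiniteDimensional B.functionField E]
            (β : E →+* B.functionField),
            (∀ b : B.functionField, β (algebraMap B.functionField E b) = b ^ p) →
            Module.finrank β.fieldRange B.functionField = p →
            Scheme.HasResolution (normalizationIn B E))) ∧
      DescentPerfectToAll := by
  rw [PalterationThesis.PerfectTransfer.palterationThesis_iff_perfect_and_descent]
  refine and_congr_left fun _ => ?_
  refine forall_congr' fun p => forall_congr' fun hp => forall_congr' fun K => ?_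
  refine forall_congr' fun _ => forall_congr' fun _ => forall_congr' fun _ => ?_
  exact and_congr_right fun _ => picoverOver_iff_r1D p hp K

end Summit.ResolutionOfSingularities.ResolutionOfSingularities.Theorems.PalterationThesis.PerfectQuotient

end
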